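import Literature.Geometry.DiscreteGeometry.KissingCertComp
import Literature.Geometry.DiscreteGeometry.KissingCertDataA
import Literature.Geometry.DiscreteGeometry.KissingCertDataB
import Literature.Geometry.DiscreteGeometry.KissingCertDataC

/-!
# Certificate for `k(4) < 25`: validation of the Gram expansion of block `r` (chunk 2)

Row-chunked kernel validation (`chunkOK`, `decide`): rows `c1 … c1+c2-1` of `zᵀ(LLᵀ)z` for the Gram block `r`
take the partial sum `certRD1f*` to `certRD2f*`.

The statements are written directly in terms of the raw data of `KissingCertData{A,B,C}`
(decoded by `ofFlat`) and the checker of `KissingCertComp`; they are combined in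
`KissingNumberFourProofs`.
-/

namespace Literature.Geometry.DiscreteGeometry

open PolyCert PolyCert.SPoly KissingFourCert

set_option maxHeartbeats 0 in
/-- Block `r`, rows `c1 … c1+c2-1`. [folklore] -/
theorem certP_r2 :
    chunkOK (GramBlk.mk certRZ certRL) certRc1 certRc2
      (ofFlat certRD1f0 ++ ofFlat certRD1f1 ++ ofFlat certRD1f2 ++ ofFlat certRD1f3 ++ ofFlat certRD1f4 ++ ofFlat certRD1f5)
      (ofFlat certRD2f0 ++ ofFlat certRD2f1 ++ ofFlat certRD2f2 ++ ofFlat certRD2f3 ++ ofFlat certRD2f4 ++ ofFlat certRD2f5) = true := by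
  decide +kernel

end Literature.Geometry.DiscreteGeometry
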